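import Literature.IUT.LogVolume.TameQuadraticCoordinates
import Literature.NumberTheory.LocalFields.PadicRootsOfUnity
import HarnessLib

/-!
# A tame radical `p`-adic field `K = ℚ_p(π)`, `π^e = p`: absolute values, coordinates, isometries, roots of unity

Classical local arithmetic (no disputed mathematics; the [IUTchIV] locator records where the abc-iut cell uses it).
Let `K` be a field which is a normed `ℚ_p`-algebra containing `π` with `π^e = p`, `e ≥ 1` (so, when `[K : ℚ_p] = e`,
`K = ℚ_p(p^{1/e})`: totally ramified of index `e`, TAMELY iff `p ∤ e`; the «first rung» of this file and its sequel
is `e ∣ p − 1`, where `μ_e ⊂ ℚ_p`).  This is the general-`e` text of abc-iut-E-t14's `TameQuadraticCoordinates`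
(`e = 2`) and of abc-iut-E-t47's `WildCubic.norm_combo` (`e = 3`).  We prove

* `norm_le_norm_sum_of_pairwise_ne` — in an ultrametric group a finite sum whose non-zero terms have PAIRWISE
  DISTINCT norms dominates each of its terms (so its norm is the maximum);
* `norm_smul_pi_pow_ne` — `‖a‖·‖π‖^i ≠ ‖b‖·‖π‖^j` for `a, b ∈ ℚ_p^×`, `i ≠ j < e` (the `e`-th powers are
  `p^{−(e·ord a + i)}` and `i ≢ j (mod e)`); hence `norm_smul_pi_pow_le_norm_sum`:
  `‖a_i‖·‖π‖^i ≤ ‖Σ_{k<e} a_k·π^k‖`, `linearIndependent_pow` (`1, π, …, π^{e−1}` independent), `exists_basis`;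
* `norm_repr_mul_le` — for the basis `B = (π^k)_{k<e}`: `‖x_k‖·‖π‖^k ≤ ‖x‖` (the max-norm in these coordinates),
  whence an ISOMETRY `σ` has `σ(π^i) = Σ_k a_{ik} π^k` with `‖a_{ik}‖·‖π‖^k ≤ ‖π‖^i`;
* `norm_natCast_e` — `‖e‖ = 1` when `e ∣ p − 1`; `exists_isPrimitiveRoot` (the tree's Gouvêa 4.6.1) and the
  discrete Fourier inversion `dft_inversion` over `μ_e(ℚ_p)`: `Σ_m ζ^{(e−i)m}·Σ_k ζ^{km}·x_k = e·x_i`;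
* `exists_subfield` — `ℚ_p(p^{1/e}) ⊆ ℚ̄_p` with `[ℚ_p(p^{1/e}) : ℚ_p] = e` (any prime `p`, any `e ≥ 1`).

Consumed by `TameRadicalIsometryStable.lean` (factorwise isometries FIX the maximal order `(R_I)^∼` of the packet
`K ⊗_{ℚ_p} K` for `e ∣ p − 1`).  Proof-only file (theorems, no definitions). [cite: NeukirchANT1999, Ch. II (5.5)]
[cite: Gouvea1993PadicNumbers, Prop. 4.6.1 (§4.6)] [cite: Mochizuki2012, IUTchIV Prop. 1.1 p. 9]
-/

noncomputable section

open Metric Set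

namespace Literature.IUT.LogVolume

namespace TameRadical

variable {p : ℕ} [Fact p.Prime]
variable {K : Type*} [NontriviallyNormedField K] [NormedAlgebra ℚ_[p] K] {π : K} {e : ℕ}

/-! ### An ultrametric sum with pairwise distinct norms dominates its terms -/

/-- In an ultrametric normed group, if the non-zero terms of a finite sum have PAIRWISE DISTINCT norms, every term is
bounded by the sum (the biggest term is strictly bigger than the rest, so the sum has its norm). [cite: NeukirchANT1999, Ch. II (5.5)] -/
theorem norm_le_norm_sum_of_pairwise_ne {M : Type*} [NormedAddCommGroup M] [IsUltrametricDist M] {ι : Type*}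
    (s : Finset ι) (x : ι → M)
    (h : ∀ i ∈ s, ∀ j ∈ s, i ≠ j → x i ≠ 0 → x j ≠ 0 → ‖x i‖ ≠ ‖x j‖) {i : ι} (hi : i ∈ s) :
    ‖x i‖ ≤ ‖∑ j ∈ s, x j‖ := by
  classical
  obtain ⟨i₀, hi₀, hmax⟩ := Finset.exists_max_image s (fun j => ‖x j‖) ⟨i, hi⟩
  by_cases h0 : x i₀ = 0
  · -- every term vanishes in norm
    have hall : ∀ j ∈ s, ‖x j‖ ≤ 0 := fun j hj => (hmax j hj).trans (by rw [h0, norm_zero])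
    have hsum : ‖∑ j ∈ s, x j‖ ≤ 0 := IsUltrametricDist.norm_sum_le_of_forall_le_of_nonneg le_rfl hall
    have hxi : ‖x i‖ = 0 := le_antisymm (hall i hi) (norm_nonneg _)
    rw [hxi]
    exact norm_nonneg _
  · have hpos : 0 < ‖x i₀‖ := norm_pos_iff.mpr h0
    -- the rest of the sum is strictly smaller than the biggest term
    have hlt : ∀ j ∈ s.erase i₀, ‖x j‖ < ‖x i₀‖ := by
      intro j hj
      obtain ⟨hji, hjs⟩ := Finset.mem_erase.mp hj
      by_cases hxj : x j = 0
      · rwa [hxj, norm_zero]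
      · exact lt_of_le_of_ne (hmax j hjs) (h j hjs i₀ hi₀ hji hxj h0)
    have hrest : ‖∑ j ∈ s.erase i₀, x j‖ < ‖x i₀‖ := by
      rcases (s.erase i₀).eq_empty_or_nonempty with hemp | hne
      · rw [hemp, Finset.sum_empty, norm_zero]; exact hpos
      · obtain ⟨j, hj, hle⟩ := IsUltrametricDist.exists_norm_finsetSum_le_of_nonempty hne (fun j => x j)
        exact hle.trans_lt (hlt j hj)
    have hsum : ‖∑ j ∈ s, x j‖ = ‖x i₀‖ := by
      rw [← Finset.add_sum_erase s x hi₀, IsUltrametricDist.norm_add_eq_max_of_norm_ne_norm (ne_of_gt hrest),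
        max_eq_left hrest.le]
    rw [hsum]
    exact hmax i hi

/-! ### Absolute values of `π` and of `ℚ_p`-multiples of its powers -/

/-- `‖π‖^e = 1/p`. [cite: NeukirchANT1999, Ch. II (5.5)] -/
theorem norm_pi_pow_e (hπ : π ^ e = (p : K)) : ‖π‖ ^ e = (p : ℝ)⁻¹ := by
  rw [← norm_pow, hπ, TameQuadratic.norm_p p]

/-- `π ≠ 0` (`e ≥ 1`). [cite: NeukirchANT1999, Ch. II (5.5)] -/
theorem pi_ne_zero (he : 0 < e) (hπ : π ^ e = (p : K)) : π ≠ 0 := by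
  intro h
  have h1 := norm_pi_pow_e hπ
  rw [h, norm_zero, zero_pow he.ne'] at h1
  have hp : (0 : ℝ) < (p : ℝ)⁻¹ := by
    have : (0 : ℝ) < p := by exact_mod_cast (Fact.out : p.Prime).pos
    positivity
  exact absurd h1 (ne_of_lt hp)

/-- `0 < ‖π‖`. [cite: NeukirchANT1999, Ch. II (5.5)] -/
theorem norm_pi_pos (he : 0 < e) (hπ : π ^ e = (p : K)) : 0 < ‖π‖ := norm_pos_iff.mpr (pi_ne_zero he hπ)

/-- `‖π‖ < 1`. [cite: NeukirchANT1999, Ch. II (5.5)] -/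
theorem norm_pi_lt_one (he : 0 < e) (hπ : π ^ e = (p : K)) : ‖π‖ < 1 := by
  have h1 : ‖π‖ ^ e < 1 := by
    rw [norm_pi_pow_e hπ]
    have : (1 : ℝ) < p := by exact_mod_cast (Fact.out : p.Prime).one_lt
    exact inv_lt_one_of_one_lt₀ this
  exact (pow_lt_one_iff_of_nonneg (norm_nonneg _) he.ne').mp h1

/-- The `e`-th power of `‖a‖·‖π‖^i` is `p^{−(e·ord(a) + i)}` (`a ∈ ℚ_p^×`). [cite: NeukirchANT1999, Ch. II (5.5)] -/
theorem norm_smul_pi_pow_pow (hπ : π ^ e = (p : K)) {a : ℚ_[p]} (ha : a ≠ 0) (i : ℕ) :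
    (‖a‖ * ‖π‖ ^ i) ^ e = (p : ℝ) ^ (-((e : ℤ) * a.valuation + i)) := by
  have hp0 : (0 : ℝ) < p := by exact_mod_cast (Fact.out : p.Prime).pos
  rw [mul_pow, ← pow_mul, mul_comm i e, pow_mul, norm_pi_pow_e hπ, Padic.norm_eq_zpow_neg_valuation ha,
    ← zpow_natCast ((p : ℝ) ^ (-a.valuation)) e, ← zpow_mul, inv_pow, ← zpow_natCast (p : ℝ) i, ← zpow_neg,
    ← zpow_add₀ hp0.ne']
  congr 1
  ring

/-- The absolute values `‖a‖·‖π‖^i` and `‖b‖·‖π‖^j` (`a, b ∈ ℚ_p^×`, `i ≠ j`, `i, j < e`) are DISTINCT: their `e`-th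
powers are `p^{−(e·ord a + i)} ≠ p^{−(e·ord b + j)}` as `i ≢ j (mod e)`. [cite: NeukirchANT1999, Ch. II (5.5)] -/
theorem norm_smul_pi_pow_ne (hπ : π ^ e = (p : K)) {a b : ℚ_[p]} (ha : a ≠ 0) (hb : b ≠ 0) {i j : ℕ}
    (hi : i < e) (hj : j < e) (hij : i ≠ j) : ‖a‖ * ‖π‖ ^ i ≠ ‖b‖ * ‖π‖ ^ j := by
  intro h
  have hp0 : (0 : ℝ) < p := by exact_mod_cast (Fact.out : p.Prime).pos
  have hp1 : (p : ℝ) ≠ 1 := by exact_mod_cast (Fact.out : p.Prime).one_lt.ne'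
  have h2 : (‖a‖ * ‖π‖ ^ i) ^ e = (‖b‖ * ‖π‖ ^ j) ^ e := by rw [h]
  rw [norm_smul_pi_pow_pow hπ ha, norm_smul_pi_pow_pow hπ hb] at h2
  have hinj := zpow_right_injective₀ hp0 hp1 h2
  have h3 : (e : ℤ) * a.valuation + i = (e : ℤ) * b.valuation + j := neg_injective hinj
  have h4 : ((i : ℤ) + e * a.valuation) % e = ((j : ℤ) + e * b.valuation) % e := by
    rw [add_comm, h3, add_comm]
  rw [Int.add_mul_emod_self_left, Int.add_mul_emod_self_left,
    Int.emod_eq_of_lt (by positivity) (by exact_mod_cast hi),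
    Int.emod_eq_of_lt (by positivity) (by exact_mod_cast hj)] at h4
  exact hij (by exact_mod_cast h4)

/-- `‖a • π^i‖ = ‖a‖·‖π‖^i`. [cite: NeukirchANT1999, Ch. II (5.5)] -/
theorem norm_smul_pi_pow (a : ℚ_[p]) (i : ℕ) : ‖a • π ^ i‖ = ‖a‖ * ‖π‖ ^ i := by
  rw [norm_smul, norm_pow]

/-- **`‖a_i‖·‖π‖^i ≤ ‖Σ_{k<e} a_k·π^k‖`** (the terms have pairwise distinct norms). [cite: NeukirchANT1999, Ch. II (5.5)] -/
theorem norm_smul_pi_pow_le_norm_sum [IsUltrametricDist K] (hπ : π ^ e = (p : K)) (a : Fin e → ℚ_[p]) (i : Fin e) :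
    ‖a i‖ * ‖π‖ ^ (i : ℕ) ≤ ‖∑ k : Fin e, a k • π ^ (k : ℕ)‖ := by
  rw [← norm_smul_pi_pow]
  refine norm_le_norm_sum_of_pairwise_ne Finset.univ (fun k : Fin e => a k • π ^ (k : ℕ)) ?_ (Finset.mem_univ i)
  intro k _ l _ hkl hk hl
  have hak : a k ≠ 0 := fun h => hk (by rw [h, zero_smul])
  have hal : a l ≠ 0 := fun h => hl (by rw [h, zero_smul])
  rw [norm_smul_pi_pow, norm_smul_pi_pow]
  exact norm_smul_pi_pow_ne hπ hak hal k.2 l.2 (fun h => hkl (Fin.ext h))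

/-- The norm of `Σ_{k<e} a_k·π^k` is at most `max_k ‖a_k‖·‖π‖^k` — so together with the previous statement it IS that
maximum (stated as a two-sided bound by a constant). [cite: NeukirchANT1999, Ch. II (5.5)] -/
theorem norm_sum_le_of_forall_le [IsUltrametricDist K] (a : Fin e → ℚ_[p]) {C : ℝ} (hC : 0 ≤ C)
    (h : ∀ k : Fin e, ‖a k‖ * ‖π‖ ^ (k : ℕ) ≤ C) : ‖∑ k : Fin e, a k • π ^ (k : ℕ)‖ ≤ C :=
  IsUltrametricDist.norm_sum_le_of_forall_le_of_nonneg hC fun k _ => by rw [norm_smul_pi_pow]; exact h k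

/-- `1, π, …, π^{e−1}` are `ℚ_p`-linearly independent. [cite: NeukirchANT1999, Ch. II (5.5)] -/
theorem linearIndependent_pow [IsUltrametricDist K] (he : 0 < e) (hπ : π ^ e = (p : K)) :
    LinearIndependent ℚ_[p] (fun i : Fin e => π ^ (i : ℕ)) := by
  refine Fintype.linearIndependent_iff.mpr fun g hg i => ?_
  have h := norm_smul_pi_pow_le_norm_sum hπ g i
  rw [hg, norm_zero] at h
  have h0 : ‖g i‖ * ‖π‖ ^ (i : ℕ) = 0 :=
    le_antisymm h (mul_nonneg (norm_nonneg _) (pow_nonneg (norm_nonneg _) _))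
  rcases mul_eq_zero.mp h0 with h1 | h1
  · exact norm_eq_zero.mp h1
  · exact absurd h1 (pow_ne_zero _ (norm_pi_pos he hπ).ne')

/-- A `ℚ_p`-basis `(π^k)_{k<e}` of `K` when `[K : ℚ_p] = e`. [cite: NeukirchANT1999, Ch. II (5.5)] -/
theorem exists_basis [IsUltrametricDist K] (he : 0 < e) (hK : Module.finrank ℚ_[p] K = e) (hπ : π ^ e = (p : K)) :
    ∃ B : Module.Basis (Fin e) ℚ_[p] K, ∀ k, B k = π ^ (k : ℕ) := by
  have hli := linearIndependent_pow he hπ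
  haveI : Nonempty (Fin e) := ⟨⟨0, he⟩⟩
  let B := basisOfLinearIndependentOfCardEqFinrank hli (by rw [hK, Fintype.card_fin])
  have hB : ⇑B = fun k : Fin e => π ^ (k : ℕ) := coe_basisOfLinearIndependentOfCardEqFinrank _ _
  exact ⟨B, fun k => by rw [hB]⟩

/-! ### Coordinates with respect to the basis `(π^k)_{k<e}` -/

section Basis

variable (B : Module.Basis (Fin e) ℚ_[p] K)

/-- Coordinates: `Σ_k x_k·π^k = x`. [cite: NeukirchANT1999, Ch. II (5.5)] -/
theorem sum_repr (hB : ∀ k, B k = π ^ (k : ℕ)) (x : K) : ∑ k : Fin e, B.repr x k • π ^ (k : ℕ) = x := by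
  conv_rhs => rw [← B.sum_repr x]
  exact Finset.sum_congr rfl fun k _ => by rw [hB]

/-- **The max-norm in the coordinates `(π^k)`: `‖x_k‖·‖π‖^k ≤ ‖x‖`.** [cite: NeukirchANT1999, Ch. II (5.5)] -/
theorem norm_repr_mul_le [IsUltrametricDist K] (hπ : π ^ e = (p : K)) (hB : ∀ k, B k = π ^ (k : ℕ)) (x : K)
    (k : Fin e) : ‖B.repr x k‖ * ‖π‖ ^ (k : ℕ) ≤ ‖x‖ := by
  conv_rhs => rw [← sum_repr B hB x]
  exact norm_smul_pi_pow_le_norm_sum hπ _ k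

/-- Coordinates of the basis vectors: `(π^i)_k = δ_{ik}`. [cite: NeukirchANT1999, Ch. II (5.5)] -/
theorem repr_pi_pow (hB : ∀ k, B k = π ^ (k : ℕ)) (i k : Fin e) :
    B.repr (π ^ (i : ℕ)) k = if i = k then 1 else 0 := by
  rw [← hB i, B.repr_self, Finsupp.single_apply]

/-- **Coefficients of an ISOMETRY** `σ` (`‖σ x‖ = ‖x‖`): `σ(π^i) = Σ_k a_{ik}·π^k` with `‖a_{ik}‖·‖π‖^k ≤ ‖π‖^i`.
[cite: NeukirchANT1999, Ch. II (5.5)] -/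
theorem isometry_coeff_bound [IsUltrametricDist K] (hπ : π ^ e = (p : K)) (hB : ∀ k, B k = π ^ (k : ℕ))
    (σ : K ≃ₗ[ℚ_[p]] K) (hσ : ∀ x, ‖σ x‖ = ‖x‖) (i k : Fin e) :
    ‖B.repr (σ (π ^ (i : ℕ))) k‖ * ‖π‖ ^ (k : ℕ) ≤ ‖π‖ ^ (i : ℕ) := by
  have h := norm_repr_mul_le B hπ hB (σ (π ^ (i : ℕ))) k
  rwa [hσ, norm_pow] at h

end Basis

/-! ### `e ∣ p − 1`: `‖e‖ = 1`, roots of unity, discrete Fourier inversion -/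

/-- `e ∣ p − 1` forces `0 < e`. [cite: Gouvea1993PadicNumbers, Prop. 4.6.1 (§4.6)] -/
theorem pos_of_dvd_sub_one (hep : e ∣ p - 1) : 0 < e := by
  have hp0 : 0 < p - 1 := Nat.sub_pos_of_lt (Fact.out : p.Prime).one_lt
  exact Nat.pos_of_dvd_of_pos hep hp0

/-- `e ∣ p − 1` forces `p ∤ e`. [cite: Gouvea1993PadicNumbers, Prop. 4.6.1 (§4.6)] -/
theorem not_dvd_of_dvd_sub_one (hep : e ∣ p - 1) : ¬ p ∣ e := by
  have hp0 : 0 < p - 1 := Nat.sub_pos_of_lt (Fact.out : p.Prime).one_lt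
  have hle : e ≤ p - 1 := Nat.le_of_dvd hp0 hep
  exact Nat.not_dvd_of_pos_of_lt (pos_of_dvd_sub_one hep) (by omega)

/-- `‖e‖ = 1` in `ℚ_p` when `p ∤ e`. [cite: Gouvea1993PadicNumbers, §4.6] -/
theorem norm_natCast_eq_one (hpe : ¬ p ∣ e) : ‖(e : ℚ_[p])‖ = 1 := by
  rw [Padic.norm_natCast_eq_one_iff]
  exact (Nat.Prime.coprime_iff_not_dvd (Fact.out : p.Prime)).mpr hpe

/-- `‖e‖ = 1` in `K` when `p ∤ e`. [cite: Gouvea1993PadicNumbers, §4.6] -/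
theorem norm_natCast_eq_one' (p : ℕ) [Fact p.Prime] [NormedAlgebra ℚ_[p] K] (hpe : ¬ p ∣ e) : ‖(e : K)‖ = 1 := by
  rw [TameQuadratic.norm_natCast p, norm_natCast_eq_one hpe]

/-- A primitive `e`-th root of unity `ζ ∈ ℚ_p` exists for `e ∣ p − 1` (the tree's Gouvêa Prop. 4.6.1), and `‖ζ^n‖ = 1`.
[cite: Gouvea1993PadicNumbers, Prop. 4.6.1 (§4.6)] -/
theorem exists_isPrimitiveRoot (hep : e ∣ p - 1) : ∃ ζ : ℚ_[p], IsPrimitiveRoot ζ e :=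
  Literature.NumberTheory.LocalFields.padic_exists_isPrimitiveRoot_of_dvd hep

/-- Powers of a root of unity have norm `1`. [cite: Gouvea1993PadicNumbers, §4.6] -/
theorem norm_pow_eq_one_of_isPrimitiveRoot {ζ : ℚ_[p]} (he : 0 < e) (hζ : IsPrimitiveRoot ζ e) (n : ℕ) :
    ‖ζ ^ n‖ = 1 := by
  refine Literature.NumberTheory.LocalFields.padic_norm_eq_one_of_pow_eq_one he.ne' ?_
  rw [← pow_mul, mul_comm, pow_mul, hζ.pow_eq_one, one_pow]

/-- Orthogonality of characters of `μ_e`: for `i, k < e`, `Σ_{m<e} ζ^{((e−i)+k)·m}` is `e` if `k = i` and `0` otherwise.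
[cite: Gouvea1993PadicNumbers, §4.6] -/
theorem sum_pow_mul_eq {ζ : ℚ_[p]} (hζ : IsPrimitiveRoot ζ e) (i k : Fin e) :
    ∑ m : Fin e, ζ ^ ((e - i + k) * (m : ℕ)) = if k = i then (e : ℚ_[p]) else 0 := by
  have hsum : ∑ m : Fin e, ζ ^ ((e - i + k) * (m : ℕ)) = ∑ m ∈ Finset.range e, (ζ ^ (e - (i : ℕ) + k)) ^ m := by
    rw [Fin.sum_univ_eq_sum_range (fun m => ζ ^ ((e - i + k) * m))]
    exact Finset.sum_congr rfl fun m _ => by rw [pow_mul]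
  rw [hsum]
  split_ifs with hki
  · subst hki
    have h1 : ζ ^ (e - (k : ℕ) + k) = 1 := by
      rw [Nat.sub_add_cancel k.2.le, hζ.pow_eq_one]
    rw [h1]
    simp
  · have hne : ζ ^ (e - (i : ℕ) + k) ≠ 1 := by
      rw [Ne, hζ.pow_eq_one_iff_dvd]
      rintro ⟨c, hc⟩
      have hi := i.2
      have hk := k.2
      rcases c with _ | _ | c
      · omega
      · apply hki
        apply Fin.ext
        omega
      · have h2e : e * 2 ≤ e * (c + 1 + 1) := Nat.mul_le_mul_left e (by omega)
        omega
    rw [geom_sum_eq hne, ← pow_mul, mul_comm, pow_mul, hζ.pow_eq_one, one_pow, sub_self, zero_div]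

/-- **Discrete Fourier inversion over `μ_e(ℚ_p)`** acting on an `e`-tuple in a `ℚ_p`-module:
`Σ_{m<e} ζ^{(e−i)m} · (Σ_{k<e} ζ^{km} · x_k) = e · x_i`. [cite: Gouvea1993PadicNumbers, §4.6] -/
theorem dft_inversion {V : Type*} [AddCommGroup V] [Module ℚ_[p] V] {ζ : ℚ_[p]} (hζ : IsPrimitiveRoot ζ e)
    (x : Fin e → V) (i : Fin e) :
    ∑ m : Fin e, ζ ^ ((e - i) * (m : ℕ)) • ∑ k : Fin e, ζ ^ ((k : ℕ) * (m : ℕ)) • x k = (e : ℚ_[p]) • x i := by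
  have h1 : ∀ m : Fin e, ζ ^ ((e - i) * (m : ℕ)) • ∑ k : Fin e, ζ ^ ((k : ℕ) * (m : ℕ)) • x k =
      ∑ k : Fin e, ζ ^ ((e - i + k) * (m : ℕ)) • x k := fun m => by
    rw [Finset.smul_sum]
    exact Finset.sum_congr rfl fun k _ => by rw [smul_smul, ← pow_add, add_mul]
  rw [Finset.sum_congr rfl fun m _ => h1 m, Finset.sum_comm]
  have h2 : ∀ k : Fin e, ∑ m : Fin e, ζ ^ ((e - i + k) * (m : ℕ)) • x k = (if k = i then (e : ℚ_[p]) else 0) • x k :=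
    fun k => by rw [← Finset.sum_smul, sum_pow_mul_eq hζ i k]
  rw [Finset.sum_congr rfl fun k _ => h2 k, Finset.sum_eq_single i (fun k _ hki => by rw [if_neg hki, zero_smul])
    (fun h => absurd (Finset.mem_univ i) h), if_pos rfl]

/-- Consequence: if every twisted sum `Σ_k ζ^{km}·x_k` (`m < e`) has norm `≤ 1` then every `x_i` has norm `≤ 1`
(`‖e‖ = ‖ζ‖ = 1`). [cite: Gouvea1993PadicNumbers, §4.6] -/
theorem norm_le_one_of_forall_norm_twisted_sum_le [IsUltrametricDist K] (hep : e ∣ p - 1) {ζ : ℚ_[p]}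
    (hζ : IsPrimitiveRoot ζ e) (x : Fin e → K) (h : ∀ m : Fin e, ‖∑ k : Fin e, ζ ^ ((k : ℕ) * (m : ℕ)) • x k‖ ≤ 1)
    (i : Fin e) : ‖x i‖ ≤ 1 := by
  have he := pos_of_dvd_sub_one hep
  have hsum := dft_inversion (V := K) hζ x i
  have hle : ‖(e : ℚ_[p]) • x i‖ ≤ 1 := by
    rw [← hsum]
    refine IsUltrametricDist.norm_sum_le_of_forall_le_of_nonneg zero_le_one fun m _ => ?_
    rw [norm_smul, norm_pow_eq_one_of_isPrimitiveRoot he hζ, one_mul]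
    exact h m
  rwa [norm_smul, norm_natCast_eq_one (not_dvd_of_dvd_sub_one hep), one_mul] at hle

end TameRadical

/-! ## Non-vacuity: `ℚ_p(p^{1/e}) ⊆ ℚ̄_p` -/

open Polynomial IntermediateField in
/-- **A tame radical subfield of `ℚ̄_p`**: for every prime `p` and every `e ≥ 1` there are `E ⊆ ℚ̄_p` with `[E : ℚ_p] = e` and
`π ∈ E`, `π^e = p` (`E = ℚ_p(p^{1/e})`; `≤ e`: the minimal polynomial divides `X^e − p`; `≥ e`: `1, π, …, π^{e−1}` are
linearly independent by the absolute values). [cite: NeukirchANT1999, Ch. II (5.5)] -/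
theorem TameRadical.exists_subfield (p : ℕ) [Fact p.Prime] {e : ℕ} (he : 0 < e) :
    ∃ (E : IntermediateField ℚ_[p] (PadicAlgCl p)) (π : E), FiniteDimensional ℚ_[p] E ∧
      Module.finrank ℚ_[p] E = e ∧ π ^ e = (p : E) := by
  obtain ⟨α, hα⟩ := IsAlgClosed.exists_pow_nat_eq (p : PadicAlgCl p) he
  have hp' : algebraMap ℚ_[p] (PadicAlgCl p) (p : ℚ_[p]) = (p : PadicAlgCl p) := map_natCast _ p
  have heval : Polynomial.aeval α (X ^ e - C (p : ℚ_[p])) = 0 := by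
    rw [map_sub, aeval_X_pow, aeval_C, hp', hα, sub_self]
  have hint : IsIntegral ℚ_[p] α := ⟨X ^ e - C (p : ℚ_[p]), monic_X_pow_sub_C _ he.ne', by
    simpa [Polynomial.aeval_def] using heval⟩
  haveI hfd : FiniteDimensional ℚ_[p] ℚ_[p]⟮α⟯ := adjoin.finiteDimensional hint
  have hπE : (⟨α, mem_adjoin_simple_self ℚ_[p] α⟩ : ℚ_[p]⟮α⟯) ^ e = (p : ℚ_[p]⟮α⟯) := by
    apply Subtype.ext
    have hpE : ((p : ℚ_[p]⟮α⟯) : PadicAlgCl p) = p := map_natCast (algebraMap ℚ_[p]⟮α⟯ (PadicAlgCl p)) p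
    rw [hpE, ← hα]
    rfl
  refine ⟨ℚ_[p]⟮α⟯, ⟨α, mem_adjoin_simple_self ℚ_[p] α⟩, hfd, le_antisymm ?_ ?_, hπE⟩
  · rw [adjoin.finrank hint]
    have hdvd : minpoly ℚ_[p] α ∣ X ^ e - C (p : ℚ_[p]) := minpoly.dvd ℚ_[p] α heval
    have hne : (X ^ e - C (p : ℚ_[p])) ≠ 0 := (monic_X_pow_sub_C _ he.ne').ne_zero
    calc (minpoly ℚ_[p] α).natDegree ≤ (X ^ e - C (p : ℚ_[p])).natDegree := natDegree_le_of_dvd hdvd hne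
      _ = e := natDegree_X_pow_sub_C
  · have hli := TameRadical.linearIndependent_pow (K := ℚ_[p]⟮α⟯) he hπE
    simpa using hli.fintype_card_le_finrank

end Literature.IUT.LogVolume

end
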